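import Literature.AlgebraicGeometry.Milne1999.LefschetzCentraliser
import Literature.AlgebraicGeometry.Motives.HyperbolicWeilTypeProduct
import Literature.AlgebraicGeometry.HodgeTheory.DegreeOneHodgeTypes
import Literature.AlgebraicGeometry.ComplexMultiplication.EndAlgebraCommSubalgebraDegreeBound
import HarnessLib

/-!
# Milne's centraliser of a product: `C(A × B) ⊂ C(A) × C(B)`, with equality iff `Hom(A, B) = 0 = Hom(B, A)` (Milne 1999, Duke 96, §1 p. 643 and Prop. 1.1 — binary case, read on `H¹`)

Family `hodge`, layer `Literature/AlgebraicGeometry/Milne1999`, namespace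
`Literature.AlgebraicGeometry.Milne1999` (D-0022). Sequel of `Milne1999/LefschetzCentraliser`
(`centralizerAlgebra A = C(A) ⊗ ℂ`, `centralizerGroup A = (C(A) ⊗ ℂ)^×`, `unitaryCentralizerGroup A h =
S(A)(ℂ)`, `similitudeCentralizerGroup A h = G(A)(ℂ)`, all read on `H¹(A(ℂ); ℂ)`), which lists
"Prop. 1.1 / 1.5 / Cor. 4.7 (product over the simple isogeny factors)" under "What is NOT here".
Written for the cell `pub-hodgecm2` (COR-CM, Hodge ladder stage 2), literature fan-out plan
`HOME/lit/LIT-FANOUT-PLAN.md` §B-v3.2 R1 item (d), PROVED rather than cited (D-0026: no named fact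
is introduced; every `def` below has a body and is a linear-algebra construction). The companion
`Milne1999/LefschetzGroupProducts` adds the polarization: `S(A × B) = S(A) × S(B)` and
`G(A × B) = G(A) ×_{𝔾_m} G(B)` (Prop. 1.5, Def. 4.6, Cor. 4.7).

## Source read (held text `paper:doi-10-1215-s0012-7094-99-09620-5` = J. S. Milne, *Lefschetz classes on abelian varieties*, Duke Math. J. 96 (1999) 639–675), verbatim

* §1, p. 643 [corpus: paper:doi-10-1215-s0012-7094-99-09620-5 p0005 L12–L16]: "For any positive
  integer `r`, `V(A^r) = rV(A)`, and the diagonal action of `C(A)` on `rV(A)` identifies `C(A)` with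
  `C(A^r)` (as `k`-algebras with involution). Let `A = A₁ × ⋯ × A_s`. Then
  `C(A) ⊂ C(A₁) × ⋯ × C(A_s)`, with equality holding if and only if `Hom(Aᵢ, Aⱼ) = 0` for all `i, j`,
  `i ≠ j`."
* §1, Prop. 1.1, p. 643 [ibid. p0005 L27–L31]: "Let `A₁, …, A_s` be a set of representatives for the
  simple isogeny factors of `A`, so that there exists an isogeny `A₁^{r₁} × ⋯ × A_s^{r_s} → A` for some
  `rᵢ > 0`. Any such isogeny induces an isomorphism `C(A₁) × ⋯ × C(A_s) → C(A)` of `k`-algebras with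
  involution, which is independent of the choice of the isogeny."
* §4, p. 658, proof of Cor. 4.2 [ibid. p0020 L45–L50]: "In general, `DC(X, Y) ≅ Hom(A, B)` […].
  Therefore, if `A` and `B` are abelian varieties with `Hom(A, B) = 0`, then `DC(A, B) = 0` and the
  projection maps define an isomorphism […]. The general statement follows from this by induction."
  — the binary step `A × B`, `Hom(A, B) = 0`, which is what this file formalizes.

## Lean rendering (the tree's carriers; `ℂ`-points; everything read on `H¹`)

As in `Milne1999/LefschetzCentraliser`, `C(A) ⊗ ℂ` acts on `H¹(A(ℂ); ℂ) = complexBetti A.X 1 =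
V(A)^∨ ⊗ ℂ` and `(C(A) ⊗ ℂ)^× = centralizerGroup A ≤ GL(H¹(A(ℂ); ℂ))` (automorphisms commuting with
every `φ^* = VanGeemen1994.pullbackOne A φ`, `φ ∈ End(A)`). The product is the tree's biproduct
`A.prod B` (`Motives/AbelianVarietyProduct`: `fst`, `snd`, `prodLift`, preadditive), and Milne's
`V(A₁ × A₂) = V(A₁) ⊕ V(A₂)` is the Künneth decomposition in degree one
`H¹((A × B)(ℂ); ℂ) = pr_A^* H¹(A) ⊕ pr_B^* H¹(B)` (the tree's `exists_eq_map_fst_add_map_snd_deg_one`,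
split by the sections `(𝟙, 0)`, `(0, 𝟙)`, `Motives.map_inlSection_map_fst_one` &c.):

* `eq_map_fst_add_map_snd_one` — `x = pr_A^* ((𝟙,0)^* x) + pr_B^* ((0,𝟙)^* x)`; the idempotents
  `e_A = (pr_A, 0)`, `e_B = (0, pr_B) ∈ End(A × B)` act as the two projectors
  (`map_projFst_one_eq`, `map_projSnd_one_eq`).
* `prodRestrictFst u = (𝟙,0)^* ∘ u ∘ pr_A^*`, `prodRestrictSnd u` — the two diagonal blocks `u_A`,
  `u_B` of an endomorphism `u` of `H¹(A × B)`; `prodBlockDiag s t = pr_A^* ∘ s ∘ (𝟙,0)^* +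
  pr_B^* ∘ t ∘ (0,𝟙)^*` — the block-diagonal endomorphism `s ⊕ t`; `prodBlockDiagEquiv` for
  automorphisms.
* **`C(A × B) ⊂ C(A) × C(B)` (PROVED)**: an element `u ∈ centralizerGroup (A.prod B)` commutes with
  `e_A^*`, `e_B^*`, hence preserves both summands (`apply_map_fst_of_mem_centralizerGroup`,
  `apply_map_snd_of_mem_centralizerGroup`) and is block diagonal
  (`prodBlockDiag_eq_of_mem_centralizerGroup`); its blocks commute with all `φ^*`, `ψ^*`
  (`φ × 𝟙_B`, `𝟙_A × ψ ∈ End(A × B)` act on the summands through `φ`, `ψ`, and `pr_A^*`, `pr_B^*` are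
  injective on `H¹`): the restrictions
  `centralizerGroup.restrictFstHom A B : centralizerGroup (A.prod B) →* GL(H¹(A(ℂ); ℂ))`,
  `centralizerGroup.restrictSndHom A B` are group homomorphisms with values in `centralizerGroup A`,
  `centralizerGroup B` (`…_mem`), jointly injective (`centralizerGroup.eq_of_restrictHom_eq`).
* **Equality iff `Hom(A, B) = 0 = Hom(B, A)` (PROVED, both directions)**: if `Hom(B, A) = 0` then every
  `χ ∈ End(A × B)` acts on `pr_A^* H¹(A)` through its `AA`-entry `(𝟙,0) ≫ χ ≫ pr_A`
  (`map_map_fst_one_of_hom_eq_zero`; the `BA`-entry is `0` and `0^* = 0` on `H¹`,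
  `complexBetti_map_zero_one`), so `s ⊕ t ∈ C(A × B)` for `s ∈ C(A)`, `t ∈ C(B)`
  (`prodBlockDiagEquiv_mem_centralizerGroup`, `centralizerGroup.exists_restrictHom_eq`); conversely
  surjectivity of `u ↦ (u_A, u_B)` forces `Hom(A, B) = 0 = Hom(B, A)`
  (`hom_eq_zero_of_restrictHom_surjective`: test `(𝟙, 2·𝟙)` against `χ = pr_B ≫ g ≫ (𝟙,0)`, which maps
  `pr_A^* H¹(A)` to `pr_B^* H¹(B)` through `g^*`, non-zero for `g ≠ 0` by the faithfulness of
  `End → End H¹`, the tree's `ComplexMultiplication.hom_eq_zero_of_complexBetti_map_one_eq_zero`).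
  Packaged: **`centralizerGroup.prodMulEquiv A B hAB hBA : centralizerGroup (A.prod B) ≃*
  (centralizerGroup A).prod (centralizerGroup B)`** — Prop. 1.1 for `s = 2`, `r₁ = r₂ = 1` and the
  identity isogeny, with the hypothesis in the form Milne's proof uses it ("abelian varieties with
  `Hom(A, B) = 0`"; both `Hom`'s are assumed, the tree having no `Hom(A, B) = 0 ⇒ Hom(B, A) = 0`).

Junk analysis: the `def`s are total linear-algebra constructions (no hypotheses, no junk values);
`prodRestrictFst u` is the `A`-block of an arbitrary `u` and is only asserted to be an
automorphism / multiplicative on `centralizerGroup (A.prod B)`.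

## What is NOT here

* The powers `A^r` ("the diagonal action identifies `C(A)` with `C(A^r)`"), `s > 2` factors (Milne:
  "by induction") and the transport along an isogeny `A₁^{r₁} × ⋯ × A_s^{r_s} → A` of Prop. 1.1 /
  1.5 / Cor. 4.7; Hom-vanishing from simplicity and non-isogeny.
* The involution and the groups `S`, `G`, `L`: file `Milne1999/LefschetzGroupProducts` (and Thm. 4.4
  itself is the cited record of `Milne1999/LefschetzCentraliser`).

## References

* [Milne1999LefschetzClasses] J. S. Milne, Lefschetz classes on abelian varieties, Duke Math. J. 96
  (1999) 639–675: §1 p. 643 (products, Prop. 1.1), §4 p. 658 (proof of Cor. 4.2).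
* [LangeBirkenhake1992] Ch. Birkenhake, H. Lange, Complex Abelian Varieties (1992), §1.1 (p. 19:
  the rational representation is an injective homomorphism).
* [HatcherAT2002] A. Hatcher, Algebraic Topology (2002), §3.2 Thm. 3.16 (Künneth).
* [Kieffer2024IsogenyGraphs] J. Kieffer (2024), §1.2.2 p. 22 (`End(A × B)` as `2 × 2` matrices).
-/

noncomputable section

open CategoryTheory
open Literature.AlgebraicTopology.SingularHomology
open Literature.AlgebraicGeometry.HodgeTheory
open Literature.AlgebraicGeometry.Motives
open Literature.Geometry.Kaehler (lefschetzPow)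
open Literature.AlgebraicGeometry.VanGeemen1994 (pullbackOne)

namespace Literature.AlgebraicGeometry.Milne1999

/-! ### Künneth bookkeeping on `H¹((A × B)(ℂ); ℂ) = pr_A^* H¹(A) ⊕ pr_B^* H¹(B)` -/

section Kunneth

variable {A B C : AbelianVariety ℂ}

/-- `(f ≫ g)^* c = f^* (g^* c)` on `Hᵏ` for homomorphisms of abelian varieties (contravariance).
[cite: FultonYoungTableaux1997, Appendix B §B.1 (1)] -/
theorem complexBetti_map_comp_apply {k : ℕ} (f : A ⟶ B) (g : B ⟶ C) (c : complexBetti C.X k) :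
    complexBetti.map (f ≫ g).hom.hom.hom k c =
      complexBetti.map f.hom.hom.hom k (complexBetti.map g.hom.hom.hom k c) :=
  (abelianVarietyHom_map_map_apply f g c).symm

/-- **Künneth in degree one, with the sections**: every `x ∈ H¹((A × B)(ℂ); ℂ)` is
`pr_A^* ((𝟙, 0)^* x) + pr_B^* ((0, 𝟙)^* x)` (`H¹(A × B) = pr_A^* H¹(A) ⊕ pr_B^* H¹(B)`, Hatcher
Thm. 3.16 in degree one, the tree's `exists_eq_map_fst_add_map_snd_deg_one`; the components are
recovered by the sections `(𝟙, 0) : A → A × B`, `(0, 𝟙) : B → A × B`, Lange–Birkenhake §1.1).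
Milne: "`V(A₁ × A₂) = V(A₁) ⊕ V(A₂)`" (§1 p. 643, the product paragraph).
[cite: HatcherAT2002, §3.2 Thm. 3.16] [cite: Milne1999LefschetzClasses, §1 p. 643] -/
theorem eq_map_fst_add_map_snd_one (x : complexBetti (A.prod B).X 1) :
    x = complexBetti.map (AbelianVariety.fst A B).hom.hom.hom 1
          (complexBetti.map (AbelianVariety.prodLift (𝟙 A) (0 : A ⟶ B)).hom.hom.hom 1 x) +
        complexBetti.map (AbelianVariety.snd A B).hom.hom.hom 1
          (complexBetti.map (AbelianVariety.prodLift (0 : B ⟶ A) (𝟙 B)).hom.hom.hom 1 x) := by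
  obtain ⟨a, b, hab⟩ := exists_eq_map_fst_add_map_snd_deg_one
    (AbelianVariety.isSmoothProjective_holds (A := A)) (AbelianVariety.isSmoothProjective_holds (A := B)) x
  change x = complexBetti.map (AbelianVariety.fst A B).hom.hom.hom 1 a +
    complexBetti.map (AbelianVariety.snd A B).hom.hom.hom 1 b at hab
  have ha : complexBetti.map (AbelianVariety.prodLift (𝟙 A) (0 : A ⟶ B)).hom.hom.hom 1 x = a := by
    rw [hab, map_add, map_inlSection_map_fst_one, map_inlSection_map_snd_one, add_zero]
  have hb : complexBetti.map (AbelianVariety.prodLift (0 : B ⟶ A) (𝟙 B)).hom.hom.hom 1 x = b := by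
    rw [hab, map_add, map_inrSection_map_fst_one, map_inrSection_map_snd_one, zero_add]
  rw [ha, hb]
  exact hab

/-- A class on `A × B` of degree one is determined by its two restrictions `(𝟙, 0)^* x`,
`(0, 𝟙)^* x`. [cite: HatcherAT2002, §3.2 Thm. 3.16] -/
theorem eq_of_map_inl_eq_of_map_inr_one {x y : complexBetti (A.prod B).X 1}
    (h₁ : complexBetti.map (AbelianVariety.prodLift (𝟙 A) (0 : A ⟶ B)).hom.hom.hom 1 x =
      complexBetti.map (AbelianVariety.prodLift (𝟙 A) (0 : A ⟶ B)).hom.hom.hom 1 y)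
    (h₂ : complexBetti.map (AbelianVariety.prodLift (0 : B ⟶ A) (𝟙 B)).hom.hom.hom 1 x =
      complexBetti.map (AbelianVariety.prodLift (0 : B ⟶ A) (𝟙 B)).hom.hom.hom 1 y) : x = y := by
  rw [eq_map_fst_add_map_snd_one x, eq_map_fst_add_map_snd_one y, h₁, h₂]

/-- The idempotent `e_A = (pr_A, 0) : A × B → A × B` acts on `pr_A^* H¹(A)` as the identity.
[cite: Milne1999LefschetzClasses, §1 p. 643] -/
theorem map_projFst_map_fst_one (a : complexBetti A.X 1) :
    complexBetti.map (AbelianVariety.prodLift (AbelianVariety.fst A B) (0 : A.prod B ⟶ B)).hom.hom.hom 1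
        (complexBetti.map (AbelianVariety.fst A B).hom.hom.hom 1 a) =
      complexBetti.map (AbelianVariety.fst A B).hom.hom.hom 1 a := by
  rw [← complexBetti_map_comp_apply, AbelianVariety.prodLift_fst]

/-- The idempotent `e_A = (pr_A, 0)` kills `pr_B^* H¹(B)` (`0^* = 0` on `H¹`). [cite: LangeBirkenhake1992, §1.1 (p. 19)] -/
theorem map_projFst_map_snd_one (b : complexBetti B.X 1) :
    complexBetti.map (AbelianVariety.prodLift (AbelianVariety.fst A B) (0 : A.prod B ⟶ B)).hom.hom.hom 1
        (complexBetti.map (AbelianVariety.snd A B).hom.hom.hom 1 b) = 0 := by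
  rw [← complexBetti_map_comp_apply, AbelianVariety.prodLift_snd, complexBetti_map_zero_one]
  rfl

/-- The idempotent `e_B = (0, pr_B)` kills `pr_A^* H¹(A)`. [cite: LangeBirkenhake1992, §1.1 (p. 19)] -/
theorem map_projSnd_map_fst_one (a : complexBetti A.X 1) :
    complexBetti.map (AbelianVariety.prodLift (0 : A.prod B ⟶ A) (AbelianVariety.snd A B)).hom.hom.hom 1
        (complexBetti.map (AbelianVariety.fst A B).hom.hom.hom 1 a) = 0 := by
  rw [← complexBetti_map_comp_apply, AbelianVariety.prodLift_fst, complexBetti_map_zero_one]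
  rfl

/-- The idempotent `e_B = (0, pr_B)` acts on `pr_B^* H¹(B)` as the identity. [cite: Milne1999LefschetzClasses, §1 p. 643] -/
theorem map_projSnd_map_snd_one (b : complexBetti B.X 1) :
    complexBetti.map (AbelianVariety.prodLift (0 : A.prod B ⟶ A) (AbelianVariety.snd A B)).hom.hom.hom 1
        (complexBetti.map (AbelianVariety.snd A B).hom.hom.hom 1 b) =
      complexBetti.map (AbelianVariety.snd A B).hom.hom.hom 1 b := by
  rw [← complexBetti_map_comp_apply, AbelianVariety.prodLift_snd]

/-- `e_A^* = pr_A^* ∘ (𝟙, 0)^*`: the projector of `H¹(A × B)` onto `pr_A^* H¹(A)` along `pr_B^* H¹(B)`.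
[cite: HatcherAT2002, §3.2 Thm. 3.16] -/
theorem map_projFst_one_eq (x : complexBetti (A.prod B).X 1) :
    complexBetti.map (AbelianVariety.prodLift (AbelianVariety.fst A B) (0 : A.prod B ⟶ B)).hom.hom.hom 1 x =
      complexBetti.map (AbelianVariety.fst A B).hom.hom.hom 1
        (complexBetti.map (AbelianVariety.prodLift (𝟙 A) (0 : A ⟶ B)).hom.hom.hom 1 x) := by
  conv_lhs => rw [eq_map_fst_add_map_snd_one x]
  rw [map_add, map_projFst_map_fst_one, map_projFst_map_snd_one, add_zero]

/-- `e_B^* = pr_B^* ∘ (0, 𝟙)^*`: the projector onto `pr_B^* H¹(B)` along `pr_A^* H¹(A)`.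
[cite: HatcherAT2002, §3.2 Thm. 3.16] -/
theorem map_projSnd_one_eq (x : complexBetti (A.prod B).X 1) :
    complexBetti.map (AbelianVariety.prodLift (0 : A.prod B ⟶ A) (AbelianVariety.snd A B)).hom.hom.hom 1 x =
      complexBetti.map (AbelianVariety.snd A B).hom.hom.hom 1
        (complexBetti.map (AbelianVariety.prodLift (0 : B ⟶ A) (𝟙 B)).hom.hom.hom 1 x) := by
  conv_lhs => rw [eq_map_fst_add_map_snd_one x]
  rw [map_add, map_projSnd_map_fst_one, map_projSnd_map_snd_one, zero_add]

end Kunneth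

/-! ### Restriction of an endomorphism of `H¹(A × B)` to the factors; block-diagonal endomorphisms -/

section Restrict

variable {A B : AbelianVariety ℂ}

/-- **The `A`-component of an endomorphism `u` of `H¹((A × B)(ℂ); ℂ)`**: `(𝟙, 0)^* ∘ u ∘ pr_A^*`, an
endomorphism of `H¹(A(ℂ); ℂ)` (the diagonal block of `u` on the summand `pr_A^* H¹(A)` of
`H¹(A × B) = pr_A^* H¹(A) ⊕ pr_B^* H¹(B)`; Milne §1 p. 643: the components of
`C(A₁ × A₂) ⊂ C(A₁) × C(A₂)` on `V(A₁ × A₂) = V(A₁) ⊕ V(A₂)`).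
[cite: Milne1999LefschetzClasses, §1 p. 643 (C(A) ⊂ C(A₁) × ⋯ × C(A_s))] -/
def prodRestrictFst (u : Module.End ℂ (complexBetti (A.prod B).X 1)) : Module.End ℂ (complexBetti A.X 1) :=
  (complexBetti.map (AbelianVariety.prodLift (𝟙 A) (0 : A ⟶ B)).hom.hom.hom 1).hom ∘ₗ u ∘ₗ
    (complexBetti.map (AbelianVariety.fst A B).hom.hom.hom 1).hom

/-- **The `B`-component of an endomorphism `u` of `H¹((A × B)(ℂ); ℂ)`**: `(0, 𝟙)^* ∘ u ∘ pr_B^*`.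
[cite: Milne1999LefschetzClasses, §1 p. 643 (C(A) ⊂ C(A₁) × ⋯ × C(A_s))] -/
def prodRestrictSnd (u : Module.End ℂ (complexBetti (A.prod B).X 1)) : Module.End ℂ (complexBetti B.X 1) :=
  (complexBetti.map (AbelianVariety.prodLift (0 : B ⟶ A) (𝟙 B)).hom.hom.hom 1).hom ∘ₗ u ∘ₗ
    (complexBetti.map (AbelianVariety.snd A B).hom.hom.hom 1).hom

/-- **The block-diagonal endomorphism `s ⊕ t`** of `H¹((A × B)(ℂ); ℂ) = pr_A^* H¹(A) ⊕ pr_B^* H¹(B)`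
with blocks `s ∈ End H¹(A(ℂ); ℂ)`, `t ∈ End H¹(B(ℂ); ℂ)`: `pr_A^* ∘ s ∘ (𝟙, 0)^* + pr_B^* ∘ t ∘ (0, 𝟙)^*`
(the action of `C(A₁) × C(A₂)` on `V(A₁) ⊕ V(A₂)`, Milne §1 p. 643).
[cite: Milne1999LefschetzClasses, §1 p. 643] -/
def prodBlockDiag (s : Module.End ℂ (complexBetti A.X 1)) (t : Module.End ℂ (complexBetti B.X 1)) :
    Module.End ℂ (complexBetti (A.prod B).X 1) :=
  (complexBetti.map (AbelianVariety.fst A B).hom.hom.hom 1).hom ∘ₗ s ∘ₗ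
      (complexBetti.map (AbelianVariety.prodLift (𝟙 A) (0 : A ⟶ B)).hom.hom.hom 1).hom +
    (complexBetti.map (AbelianVariety.snd A B).hom.hom.hom 1).hom ∘ₗ t ∘ₗ
      (complexBetti.map (AbelianVariety.prodLift (0 : B ⟶ A) (𝟙 B)).hom.hom.hom 1).hom

/-- `prodRestrictFst u a = (𝟙, 0)^* (u (pr_A^* a))`. [cite: Milne1999LefschetzClasses, §1 p. 643 (V(A₁ × A₂) = V(A₁) ⊕ V(A₂), C(A) ⊂ C(A₁) × C(A₂))] -/
theorem prodRestrictFst_apply (u : Module.End ℂ (complexBetti (A.prod B).X 1)) (a : complexBetti A.X 1) :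
    prodRestrictFst u a = complexBetti.map (AbelianVariety.prodLift (𝟙 A) (0 : A ⟶ B)).hom.hom.hom 1
      (u (complexBetti.map (AbelianVariety.fst A B).hom.hom.hom 1 a)) :=
  rfl

/-- `prodRestrictSnd u b = (0, 𝟙)^* (u (pr_B^* b))`. [cite: Milne1999LefschetzClasses, §1 p. 643 (V(A₁ × A₂) = V(A₁) ⊕ V(A₂), C(A) ⊂ C(A₁) × C(A₂))] -/
theorem prodRestrictSnd_apply (u : Module.End ℂ (complexBetti (A.prod B).X 1)) (b : complexBetti B.X 1) :
    prodRestrictSnd u b = complexBetti.map (AbelianVariety.prodLift (0 : B ⟶ A) (𝟙 B)).hom.hom.hom 1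
      (u (complexBetti.map (AbelianVariety.snd A B).hom.hom.hom 1 b)) :=
  rfl

/-- `(s ⊕ t) x = pr_A^* (s ((𝟙,0)^* x)) + pr_B^* (t ((0,𝟙)^* x))`. [cite: Milne1999LefschetzClasses, §1 p. 643 (V(A₁ × A₂) = V(A₁) ⊕ V(A₂), C(A) ⊂ C(A₁) × C(A₂))] -/
theorem prodBlockDiag_apply (s : Module.End ℂ (complexBetti A.X 1)) (t : Module.End ℂ (complexBetti B.X 1))
    (x : complexBetti (A.prod B).X 1) :
    prodBlockDiag s t x =
      complexBetti.map (AbelianVariety.fst A B).hom.hom.hom 1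
          (s (complexBetti.map (AbelianVariety.prodLift (𝟙 A) (0 : A ⟶ B)).hom.hom.hom 1 x)) +
        complexBetti.map (AbelianVariety.snd A B).hom.hom.hom 1
          (t (complexBetti.map (AbelianVariety.prodLift (0 : B ⟶ A) (𝟙 B)).hom.hom.hom 1 x)) :=
  rfl

/-- `(s ⊕ t) (pr_A^* a) = pr_A^* (s a)`. [cite: Milne1999LefschetzClasses, §1 p. 643 (V(A₁ × A₂) = V(A₁) ⊕ V(A₂), C(A) ⊂ C(A₁) × C(A₂))] -/
theorem prodBlockDiag_apply_map_fst (s : Module.End ℂ (complexBetti A.X 1))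
    (t : Module.End ℂ (complexBetti B.X 1)) (a : complexBetti A.X 1) :
    prodBlockDiag s t (complexBetti.map (AbelianVariety.fst A B).hom.hom.hom 1 a) =
      complexBetti.map (AbelianVariety.fst A B).hom.hom.hom 1 (s a) := by
  rw [prodBlockDiag_apply, map_inlSection_map_fst_one, map_inrSection_map_fst_one, map_zero, map_zero,
    add_zero]

/-- `(s ⊕ t) (pr_B^* b) = pr_B^* (t b)`. [cite: Milne1999LefschetzClasses, §1 p. 643 (V(A₁ × A₂) = V(A₁) ⊕ V(A₂), C(A) ⊂ C(A₁) × C(A₂))] -/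
theorem prodBlockDiag_apply_map_snd (s : Module.End ℂ (complexBetti A.X 1))
    (t : Module.End ℂ (complexBetti B.X 1)) (b : complexBetti B.X 1) :
    prodBlockDiag s t (complexBetti.map (AbelianVariety.snd A B).hom.hom.hom 1 b) =
      complexBetti.map (AbelianVariety.snd A B).hom.hom.hom 1 (t b) := by
  rw [prodBlockDiag_apply, map_inlSection_map_snd_one, map_inrSection_map_snd_one, map_zero, map_zero,
    zero_add]

/-- The `A`-block of `s ⊕ t` is `s`. [cite: Milne1999LefschetzClasses, §1 p. 643 (V(A₁ × A₂) = V(A₁) ⊕ V(A₂), C(A) ⊂ C(A₁) × C(A₂))] -/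
theorem prodRestrictFst_prodBlockDiag (s : Module.End ℂ (complexBetti A.X 1))
    (t : Module.End ℂ (complexBetti B.X 1)) : prodRestrictFst (prodBlockDiag s t) = s := by
  refine LinearMap.ext fun a ↦ ?_
  rw [prodRestrictFst_apply, prodBlockDiag_apply_map_fst, map_inlSection_map_fst_one]

/-- The `B`-block of `s ⊕ t` is `t`. [cite: Milne1999LefschetzClasses, §1 p. 643 (V(A₁ × A₂) = V(A₁) ⊕ V(A₂), C(A) ⊂ C(A₁) × C(A₂))] -/
theorem prodRestrictSnd_prodBlockDiag (s : Module.End ℂ (complexBetti A.X 1))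
    (t : Module.End ℂ (complexBetti B.X 1)) : prodRestrictSnd (prodBlockDiag s t) = t := by
  refine LinearMap.ext fun b ↦ ?_
  rw [prodRestrictSnd_apply, prodBlockDiag_apply_map_snd, map_inrSection_map_snd_one]

/-- `𝟙 ⊕ 𝟙 = 𝟙` (Künneth: `x = pr_A^* (𝟙,0)^* x + pr_B^* (0,𝟙)^* x`). [cite: HatcherAT2002, §3.2 Thm. 3.16] -/
theorem prodBlockDiag_one : prodBlockDiag (1 : Module.End ℂ (complexBetti A.X 1))
    (1 : Module.End ℂ (complexBetti B.X 1)) = 1 := by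
  refine LinearMap.ext fun x ↦ ?_
  rw [prodBlockDiag_apply, Module.End.one_apply, Module.End.one_apply, Module.End.one_apply]
  exact (eq_map_fst_add_map_snd_one x).symm

/-- `(s ⊕ t) ∘ (s' ⊕ t') = (s s') ⊕ (t t')`. [cite: Milne1999LefschetzClasses, §1 p. 643 (V(A₁ × A₂) = V(A₁) ⊕ V(A₂), C(A) ⊂ C(A₁) × C(A₂))] -/
theorem prodBlockDiag_mul (s s' : Module.End ℂ (complexBetti A.X 1)) (t t' : Module.End ℂ (complexBetti B.X 1)) :
    prodBlockDiag (s * s') (t * t') = prodBlockDiag s t * prodBlockDiag s' t' := by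
  refine LinearMap.ext fun x ↦ ?_
  rw [Module.End.mul_apply, prodBlockDiag_apply, prodBlockDiag_apply s' t', map_add,
    prodBlockDiag_apply_map_fst, prodBlockDiag_apply_map_snd, Module.End.mul_apply, Module.End.mul_apply]

/-- `prodRestrictFst 1 = 1` (`(𝟙,0)^* pr_A^* = 𝟙`). [cite: Milne1999LefschetzClasses, §1 p. 643 (V(A₁ × A₂) = V(A₁) ⊕ V(A₂), C(A) ⊂ C(A₁) × C(A₂))] -/
theorem prodRestrictFst_one : prodRestrictFst (1 : Module.End ℂ (complexBetti (A.prod B).X 1)) = 1 := by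
  refine LinearMap.ext fun a ↦ ?_
  rw [prodRestrictFst_apply, Module.End.one_apply, Module.End.one_apply, map_inlSection_map_fst_one]

/-- `prodRestrictSnd 1 = 1`. [cite: Milne1999LefschetzClasses, §1 p. 643 (V(A₁ × A₂) = V(A₁) ⊕ V(A₂), C(A) ⊂ C(A₁) × C(A₂))] -/
theorem prodRestrictSnd_one : prodRestrictSnd (1 : Module.End ℂ (complexBetti (A.prod B).X 1)) = 1 := by
  refine LinearMap.ext fun b ↦ ?_
  rw [prodRestrictSnd_apply, Module.End.one_apply, Module.End.one_apply, map_inrSection_map_snd_one]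

/-- **An endomorphism preserving both summands `pr_A^* H¹(A)`, `pr_B^* H¹(B)` is the block-diagonal
endomorphism of its two components**: if `u (pr_A^* a) = pr_A^* (u_A a)` and `u (pr_B^* b) = pr_B^* (u_B b)`
for all `a`, `b` (`u_A = prodRestrictFst u`, `u_B = prodRestrictSnd u`), then `u = u_A ⊕ u_B`. [cite: Milne1999LefschetzClasses, §1 p. 643 (V(A₁ × A₂) = V(A₁) ⊕ V(A₂), C(A) ⊂ C(A₁) × C(A₂))] -/
theorem prodBlockDiag_prodRestrict_eq {u : Module.End ℂ (complexBetti (A.prod B).X 1)}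
    (h₁ : ∀ a : complexBetti A.X 1, u (complexBetti.map (AbelianVariety.fst A B).hom.hom.hom 1 a) =
      complexBetti.map (AbelianVariety.fst A B).hom.hom.hom 1 (prodRestrictFst u a))
    (h₂ : ∀ b : complexBetti B.X 1, u (complexBetti.map (AbelianVariety.snd A B).hom.hom.hom 1 b) =
      complexBetti.map (AbelianVariety.snd A B).hom.hom.hom 1 (prodRestrictSnd u b)) :
    prodBlockDiag (prodRestrictFst u) (prodRestrictSnd u) = u := by
  refine LinearMap.ext fun x ↦ ?_
  rw [prodBlockDiag_apply, ← h₁, ← h₂, ← map_add, ← eq_map_fst_add_map_snd_one x]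

end Restrict

/-! ### `C(A × B) ⊂ C(A) × C(B)` (Milne §1 p. 643): elements of `C(A × B)` are block diagonal, with blocks in `C(A)`, `C(B)` -/

section Centralizer

variable {A B : AbelianVariety ℂ} {u v : complexBetti (A.prod B).X 1 ≃ₗ[ℂ] complexBetti (A.prod B).X 1}

/-- **An element of `C(A × B)` preserves the summand `pr_A^* H¹(A)`**: `u (pr_A^* a) = pr_A^* (u_A a)`,
`u_A` its `A`-component — `u` commutes with `e_A^*`, `e_A = (pr_A, 0) ∈ End(A × B)` the idempotent
cutting out `A × 0`, and `e_A^*` is the projector onto `pr_A^* H¹(A)` (Milne §1 p. 643: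
"`C(A) ⊂ C(A₁) × ⋯ × C(A_s)`" for `A = A₁ × ⋯ × A_s`). [cite: Milne1999LefschetzClasses, §1 p. 643] -/
theorem apply_map_fst_of_mem_centralizerGroup (hu : u ∈ centralizerGroup (A.prod B)) (a : complexBetti A.X 1) :
    u (complexBetti.map (AbelianVariety.fst A B).hom.hom.hom 1 a) =
      complexBetti.map (AbelianVariety.fst A B).hom.hom.hom 1 (prodRestrictFst u.toLinearMap a) := by
  have h := mem_centralizerGroup_iff.1 hu
    (AbelianVariety.prodLift (AbelianVariety.fst A B) (0 : A.prod B ⟶ B))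
    (complexBetti.map (AbelianVariety.fst A B).hom.hom.hom 1 a)
  change u (complexBetti.map _ 1 (complexBetti.map _ 1 a)) = complexBetti.map _ 1 (u _) at h
  rw [map_projFst_map_fst_one, map_projFst_one_eq] at h
  exact h

/-- **An element of `C(A × B)` preserves the summand `pr_B^* H¹(B)`**: `u (pr_B^* b) = pr_B^* (u_B b)`
(commute `u` with `e_B^*`, `e_B = (0, pr_B)`). [cite: Milne1999LefschetzClasses, §1 p. 643] -/
theorem apply_map_snd_of_mem_centralizerGroup (hu : u ∈ centralizerGroup (A.prod B)) (b : complexBetti B.X 1) :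
    u (complexBetti.map (AbelianVariety.snd A B).hom.hom.hom 1 b) =
      complexBetti.map (AbelianVariety.snd A B).hom.hom.hom 1 (prodRestrictSnd u.toLinearMap b) := by
  have h := mem_centralizerGroup_iff.1 hu
    (AbelianVariety.prodLift (0 : A.prod B ⟶ A) (AbelianVariety.snd A B))
    (complexBetti.map (AbelianVariety.snd A B).hom.hom.hom 1 b)
  change u (complexBetti.map _ 1 (complexBetti.map _ 1 b)) = complexBetti.map _ 1 (u _) at h
  rw [map_projSnd_map_snd_one, map_projSnd_one_eq] at h
  exact h

/-- **`C(A × B)` is block diagonal**: `u = u_A ⊕ u_B` for `u ∈ C(A × B)`. [cite: Milne1999LefschetzClasses, §1 p. 643] -/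
theorem prodBlockDiag_eq_of_mem_centralizerGroup (hu : u ∈ centralizerGroup (A.prod B)) :
    prodBlockDiag (prodRestrictFst u.toLinearMap) (prodRestrictSnd u.toLinearMap) = u.toLinearMap :=
  prodBlockDiag_prodRestrict_eq (apply_map_fst_of_mem_centralizerGroup hu)
    (apply_map_snd_of_mem_centralizerGroup hu)

/-- Taking the `A`-component is multiplicative on `C(A × B)`. [cite: Milne1999LefschetzClasses, §1 p. 643 (V(A₁ × A₂) = V(A₁) ⊕ V(A₂), C(A) ⊂ C(A₁) × C(A₂))] -/
theorem prodRestrictFst_mul_of_mem_centralizerGroup (hv : v ∈ centralizerGroup (A.prod B)) :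
    prodRestrictFst (u * v).toLinearMap = prodRestrictFst u.toLinearMap * prodRestrictFst v.toLinearMap := by
  refine LinearMap.ext fun a ↦ ?_
  rw [Module.End.mul_apply, prodRestrictFst_apply, prodRestrictFst_apply, LinearEquiv.coe_coe,
    LinearEquiv.coe_coe, LinearEquiv.mul_apply, apply_map_fst_of_mem_centralizerGroup hv, prodRestrictFst_apply,
    LinearEquiv.coe_coe]

/-- Taking the `B`-component is multiplicative on `C(A × B)`. [cite: Milne1999LefschetzClasses, §1 p. 643 (V(A₁ × A₂) = V(A₁) ⊕ V(A₂), C(A) ⊂ C(A₁) × C(A₂))] -/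
theorem prodRestrictSnd_mul_of_mem_centralizerGroup (hv : v ∈ centralizerGroup (A.prod B)) :
    prodRestrictSnd (u * v).toLinearMap = prodRestrictSnd u.toLinearMap * prodRestrictSnd v.toLinearMap := by
  refine LinearMap.ext fun b ↦ ?_
  rw [Module.End.mul_apply, prodRestrictSnd_apply, prodRestrictSnd_apply, LinearEquiv.coe_coe,
    LinearEquiv.coe_coe, LinearEquiv.mul_apply, apply_map_snd_of_mem_centralizerGroup hv, prodRestrictSnd_apply,
    LinearEquiv.coe_coe]

/-- **The `A`-component of `u ∈ C(A × B)` commutes with every `φ^*`, `φ ∈ End(A)`** — it lies in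
`C(A) ⊗ ℂ`: `φ × 𝟙_B ∈ End(A × B)` acts on `pr_A^* H¹(A)` through `φ`, and `pr_A^*` is injective on `H¹`.
[cite: Milne1999LefschetzClasses, §1 p. 643 (C(A) ⊂ C(A₁) × ⋯ × C(A_s))] -/
theorem prodRestrictFst_apply_pullbackOne (hu : u ∈ centralizerGroup (A.prod B)) (φ : A ⟶ A)
    (a : complexBetti A.X 1) :
    prodRestrictFst u.toLinearMap (pullbackOne A φ a) = pullbackOne A φ (prodRestrictFst u.toLinearMap a) := by
  apply map_fst_injective_one (A := A) (B := B)
  change complexBetti.map (AbelianVariety.fst A B).hom.hom.hom 1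
      (prodRestrictFst u.toLinearMap (complexBetti.map φ.hom.hom.hom 1 a)) =
    complexBetti.map (AbelianVariety.fst A B).hom.hom.hom 1
      (complexBetti.map φ.hom.hom.hom 1 (prodRestrictFst u.toLinearMap a))
  rw [← apply_map_fst_of_mem_centralizerGroup hu, ← map_prodLift_map_fst φ (𝟙 B),
    ← map_prodLift_map_fst φ (𝟙 B), ← apply_map_fst_of_mem_centralizerGroup hu]
  exact mem_centralizerGroup_iff.1 hu _ _

/-- **The `B`-component of `u ∈ C(A × B)` commutes with every `ψ^*`, `ψ ∈ End(B)`.**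
[cite: Milne1999LefschetzClasses, §1 p. 643 (C(A) ⊂ C(A₁) × ⋯ × C(A_s))] -/
theorem prodRestrictSnd_apply_pullbackOne (hu : u ∈ centralizerGroup (A.prod B)) (ψ : B ⟶ B)
    (b : complexBetti B.X 1) :
    prodRestrictSnd u.toLinearMap (pullbackOne B ψ b) = pullbackOne B ψ (prodRestrictSnd u.toLinearMap b) := by
  apply map_snd_injective_one (A := A) (B := B)
  change complexBetti.map (AbelianVariety.snd A B).hom.hom.hom 1
      (prodRestrictSnd u.toLinearMap (complexBetti.map ψ.hom.hom.hom 1 b)) =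
    complexBetti.map (AbelianVariety.snd A B).hom.hom.hom 1
      (complexBetti.map ψ.hom.hom.hom 1 (prodRestrictSnd u.toLinearMap b))
  rw [← apply_map_snd_of_mem_centralizerGroup hu, ← map_prodLift_map_snd (𝟙 A) ψ,
    ← map_prodLift_map_snd (𝟙 A) ψ, ← apply_map_snd_of_mem_centralizerGroup hu]
  exact mem_centralizerGroup_iff.1 hu _ _

/-- `u_A ∘ (u⁻¹)_A = 𝟙` for `u ∈ C(A × B)`. [cite: Milne1999LefschetzClasses, §1 p. 643 (V(A₁ × A₂) = V(A₁) ⊕ V(A₂), C(A) ⊂ C(A₁) × C(A₂))] -/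
theorem centralizerGroup.prodRestrictFst_comp_inv (u : centralizerGroup (A.prod B)) :
    prodRestrictFst (u : complexBetti (A.prod B).X 1 ≃ₗ[ℂ] complexBetti (A.prod B).X 1).toLinearMap ∘ₗ
        prodRestrictFst ((u⁻¹ : centralizerGroup (A.prod B)) :
          complexBetti (A.prod B).X 1 ≃ₗ[ℂ] complexBetti (A.prod B).X 1).toLinearMap = LinearMap.id := by
  rw [← Module.End.mul_eq_comp, ← prodRestrictFst_mul_of_mem_centralizerGroup (u⁻¹).2, ← Subgroup.coe_mul,
    mul_inv_cancel, Subgroup.coe_one]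
  exact prodRestrictFst_one

/-- `u_B ∘ (u⁻¹)_B = 𝟙` for `u ∈ C(A × B)`. [cite: Milne1999LefschetzClasses, §1 p. 643 (V(A₁ × A₂) = V(A₁) ⊕ V(A₂), C(A) ⊂ C(A₁) × C(A₂))] -/
theorem centralizerGroup.prodRestrictSnd_comp_inv (u : centralizerGroup (A.prod B)) :
    prodRestrictSnd (u : complexBetti (A.prod B).X 1 ≃ₗ[ℂ] complexBetti (A.prod B).X 1).toLinearMap ∘ₗ
        prodRestrictSnd ((u⁻¹ : centralizerGroup (A.prod B)) :
          complexBetti (A.prod B).X 1 ≃ₗ[ℂ] complexBetti (A.prod B).X 1).toLinearMap = LinearMap.id := by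
  rw [← Module.End.mul_eq_comp, ← prodRestrictSnd_mul_of_mem_centralizerGroup (u⁻¹).2, ← Subgroup.coe_mul,
    mul_inv_cancel, Subgroup.coe_one]
  exact prodRestrictSnd_one

variable (A B)

/-- **The restriction `C(A × B) → GL(H¹(A(ℂ); ℂ))`, `u ↦ u_A`** (the `A`-component, an automorphism
with inverse `(u⁻¹)_A`), as a group homomorphism; its values lie in `C(A)`
(`centralizerGroup.restrictFstHom_mem`). Milne §1 p. 643: the first projection of
`C(A₁ × A₂) ⊂ C(A₁) × C(A₂)`. [cite: Milne1999LefschetzClasses, §1 p. 643] -/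
def centralizerGroup.restrictFstHom :
    centralizerGroup (A.prod B) →* (complexBetti A.X 1 ≃ₗ[ℂ] complexBetti A.X 1) where
  toFun u := LinearEquiv.ofLinear
      (prodRestrictFst (u : complexBetti (A.prod B).X 1 ≃ₗ[ℂ] complexBetti (A.prod B).X 1).toLinearMap)
      (prodRestrictFst ((u⁻¹ : centralizerGroup (A.prod B)) :
        complexBetti (A.prod B).X 1 ≃ₗ[ℂ] complexBetti (A.prod B).X 1).toLinearMap)
      (centralizerGroup.prodRestrictFst_comp_inv u)
      (by simpa only [inv_inv] using centralizerGroup.prodRestrictFst_comp_inv u⁻¹)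
  map_one' := by
    refine LinearEquiv.ext fun a ↦ ?_
    rw [LinearEquiv.ofLinear_apply, Subgroup.coe_one]
    change prodRestrictFst (1 : Module.End ℂ (complexBetti (A.prod B).X 1)) a = a
    rw [prodRestrictFst_one, Module.End.one_apply]
  map_mul' u v := by
    refine LinearEquiv.ext fun a ↦ ?_
    rw [LinearEquiv.ofLinear_apply, Subgroup.coe_mul, prodRestrictFst_mul_of_mem_centralizerGroup v.2,
      LinearEquiv.mul_apply, LinearEquiv.ofLinear_apply, LinearEquiv.ofLinear_apply, Module.End.mul_apply]

/-- **The restriction `C(A × B) → GL(H¹(B(ℂ); ℂ))`, `u ↦ u_B`**, a group homomorphism with values in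
`C(B)`. [cite: Milne1999LefschetzClasses, §1 p. 643] -/
def centralizerGroup.restrictSndHom :
    centralizerGroup (A.prod B) →* (complexBetti B.X 1 ≃ₗ[ℂ] complexBetti B.X 1) where
  toFun u := LinearEquiv.ofLinear
      (prodRestrictSnd (u : complexBetti (A.prod B).X 1 ≃ₗ[ℂ] complexBetti (A.prod B).X 1).toLinearMap)
      (prodRestrictSnd ((u⁻¹ : centralizerGroup (A.prod B)) :
        complexBetti (A.prod B).X 1 ≃ₗ[ℂ] complexBetti (A.prod B).X 1).toLinearMap)
      (centralizerGroup.prodRestrictSnd_comp_inv u)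
      (by simpa only [inv_inv] using centralizerGroup.prodRestrictSnd_comp_inv u⁻¹)
  map_one' := by
    refine LinearEquiv.ext fun b ↦ ?_
    rw [LinearEquiv.ofLinear_apply, Subgroup.coe_one]
    change prodRestrictSnd (1 : Module.End ℂ (complexBetti (A.prod B).X 1)) b = b
    rw [prodRestrictSnd_one, Module.End.one_apply]
  map_mul' u v := by
    refine LinearEquiv.ext fun b ↦ ?_
    rw [LinearEquiv.ofLinear_apply, Subgroup.coe_mul, prodRestrictSnd_mul_of_mem_centralizerGroup v.2,
      LinearEquiv.mul_apply, LinearEquiv.ofLinear_apply, LinearEquiv.ofLinear_apply, Module.End.mul_apply]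

variable {A B}

/-- The underlying linear map of `restrictFstHom u` is the `A`-component `prodRestrictFst u`. [cite: Milne1999LefschetzClasses, §1 p. 643 (V(A₁ × A₂) = V(A₁) ⊕ V(A₂), C(A) ⊂ C(A₁) × C(A₂))] -/
theorem centralizerGroup.coe_restrictFstHom (u : centralizerGroup (A.prod B)) :
    (centralizerGroup.restrictFstHom A B u).toLinearMap =
      prodRestrictFst (u : complexBetti (A.prod B).X 1 ≃ₗ[ℂ] complexBetti (A.prod B).X 1).toLinearMap :=
  rfl

/-- The underlying linear map of `restrictSndHom u` is the `B`-component `prodRestrictSnd u`. [cite: Milne1999LefschetzClasses, §1 p. 643 (V(A₁ × A₂) = V(A₁) ⊕ V(A₂), C(A) ⊂ C(A₁) × C(A₂))] -/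
theorem centralizerGroup.coe_restrictSndHom (u : centralizerGroup (A.prod B)) :
    (centralizerGroup.restrictSndHom A B u).toLinearMap =
      prodRestrictSnd (u : complexBetti (A.prod B).X 1 ≃ₗ[ℂ] complexBetti (A.prod B).X 1).toLinearMap :=
  rfl

/-- `restrictFstHom u a = (𝟙,0)^* (u (pr_A^* a))`. [cite: Milne1999LefschetzClasses, §1 p. 643 (V(A₁ × A₂) = V(A₁) ⊕ V(A₂), C(A) ⊂ C(A₁) × C(A₂))] -/
theorem centralizerGroup.restrictFstHom_apply (u : centralizerGroup (A.prod B)) (a : complexBetti A.X 1) :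
    centralizerGroup.restrictFstHom A B u a =
      complexBetti.map (AbelianVariety.prodLift (𝟙 A) (0 : A ⟶ B)).hom.hom.hom 1
        ((u : complexBetti (A.prod B).X 1 ≃ₗ[ℂ] complexBetti (A.prod B).X 1)
          (complexBetti.map (AbelianVariety.fst A B).hom.hom.hom 1 a)) :=
  rfl

/-- `restrictSndHom u b = (0,𝟙)^* (u (pr_B^* b))`. [cite: Milne1999LefschetzClasses, §1 p. 643 (V(A₁ × A₂) = V(A₁) ⊕ V(A₂), C(A) ⊂ C(A₁) × C(A₂))] -/
theorem centralizerGroup.restrictSndHom_apply (u : centralizerGroup (A.prod B)) (b : complexBetti B.X 1) :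
    centralizerGroup.restrictSndHom A B u b =
      complexBetti.map (AbelianVariety.prodLift (0 : B ⟶ A) (𝟙 B)).hom.hom.hom 1
        ((u : complexBetti (A.prod B).X 1 ≃ₗ[ℂ] complexBetti (A.prod B).X 1)
          (complexBetti.map (AbelianVariety.snd A B).hom.hom.hom 1 b)) :=
  rfl

/-- **`u_A ∈ C(A)`** for `u ∈ C(A × B)` (Milne: `C(A₁ × A₂) ⊂ C(A₁) × C(A₂)`, first factor).
[cite: Milne1999LefschetzClasses, §1 p. 643] -/
theorem centralizerGroup.restrictFstHom_mem (u : centralizerGroup (A.prod B)) :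
    centralizerGroup.restrictFstHom A B u ∈ centralizerGroup A :=
  fun φ a ↦ prodRestrictFst_apply_pullbackOne u.2 φ a

/-- **`u_B ∈ C(B)`** for `u ∈ C(A × B)` (second factor). [cite: Milne1999LefschetzClasses, §1 p. 643] -/
theorem centralizerGroup.restrictSndHom_mem (u : centralizerGroup (A.prod B)) :
    centralizerGroup.restrictSndHom A B u ∈ centralizerGroup B :=
  fun ψ b ↦ prodRestrictSnd_apply_pullbackOne u.2 ψ b

/-- `u (pr_A^* a) = pr_A^* (u_A a)` in terms of `restrictFstHom`. [cite: Milne1999LefschetzClasses, §1 p. 643] -/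
theorem centralizerGroup.apply_map_fst (u : centralizerGroup (A.prod B)) (a : complexBetti A.X 1) :
    (u : complexBetti (A.prod B).X 1 ≃ₗ[ℂ] complexBetti (A.prod B).X 1)
        (complexBetti.map (AbelianVariety.fst A B).hom.hom.hom 1 a) =
      complexBetti.map (AbelianVariety.fst A B).hom.hom.hom 1 (centralizerGroup.restrictFstHom A B u a) :=
  apply_map_fst_of_mem_centralizerGroup u.2 a

/-- `u (pr_B^* b) = pr_B^* (u_B b)` in terms of `restrictSndHom`. [cite: Milne1999LefschetzClasses, §1 p. 643] -/
theorem centralizerGroup.apply_map_snd (u : centralizerGroup (A.prod B)) (b : complexBetti B.X 1) :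
    (u : complexBetti (A.prod B).X 1 ≃ₗ[ℂ] complexBetti (A.prod B).X 1)
        (complexBetti.map (AbelianVariety.snd A B).hom.hom.hom 1 b) =
      complexBetti.map (AbelianVariety.snd A B).hom.hom.hom 1 (centralizerGroup.restrictSndHom A B u b) :=
  apply_map_snd_of_mem_centralizerGroup u.2 b

/-- **`C(A × B) → C(A) × C(B)` is injective**: an element of `C(A × B)` is determined by its two
components (`u = u_A ⊕ u_B`). Milne: "`C(A) ⊂ C(A₁) × ⋯ × C(A_s)`". [cite: Milne1999LefschetzClasses, §1 p. 643] -/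
theorem centralizerGroup.eq_of_restrictHom_eq {u v : centralizerGroup (A.prod B)}
    (h₁ : centralizerGroup.restrictFstHom A B u = centralizerGroup.restrictFstHom A B v)
    (h₂ : centralizerGroup.restrictSndHom A B u = centralizerGroup.restrictSndHom A B v) : u = v := by
  have e₁ := congrArg LinearEquiv.toLinearMap h₁
  have e₂ := congrArg LinearEquiv.toLinearMap h₂
  rw [centralizerGroup.coe_restrictFstHom, centralizerGroup.coe_restrictFstHom] at e₁
  rw [centralizerGroup.coe_restrictSndHom, centralizerGroup.coe_restrictSndHom] at e₂
  refine Subtype.ext (LinearEquiv.toLinearMap_injective ?_)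
  rw [← prodBlockDiag_eq_of_mem_centralizerGroup u.2, ← prodBlockDiag_eq_of_mem_centralizerGroup v.2, e₁, e₂]

end Centralizer

/-! ### `C(A × B) = C(A) × C(B)` iff `Hom(A, B) = 0 = Hom(B, A)` (Milne §1 p. 643, Prop. 1.1) -/

section HomZero

variable {A B : AbelianVariety ℂ}

/-- For `χ ∈ End(A × B)`: `(𝟙,0)^* χ^* pr_A^* a = ((𝟙,0) ≫ χ ≫ pr_A)^* a` — the `AA`-entry of `χ`
acts on `H¹(A)`. [cite: Milne1999LefschetzClasses, §1 p. 643 (V(A₁ × A₂) = V(A₁) ⊕ V(A₂), C(A) ⊂ C(A₁) × C(A₂))] -/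
theorem map_inl_map_map_fst_one (χ : A.prod B ⟶ A.prod B) (a : complexBetti A.X 1) :
    complexBetti.map (AbelianVariety.prodLift (𝟙 A) (0 : A ⟶ B)).hom.hom.hom 1
        (complexBetti.map χ.hom.hom.hom 1 (complexBetti.map (AbelianVariety.fst A B).hom.hom.hom 1 a)) =
      complexBetti.map (AbelianVariety.prodLift (𝟙 A) (0 : A ⟶ B) ≫ χ ≫ AbelianVariety.fst A B).hom.hom.hom 1 a := by
  rw [complexBetti_map_comp_apply, complexBetti_map_comp_apply]

/-- For `χ ∈ End(A × B)`: `(0,𝟙)^* χ^* pr_B^* b = ((0,𝟙) ≫ χ ≫ pr_B)^* b` — the `BB`-entry of `χ`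
acts on `H¹(B)`. [cite: Milne1999LefschetzClasses, §1 p. 643 (V(A₁ × A₂) = V(A₁) ⊕ V(A₂), C(A) ⊂ C(A₁) × C(A₂))] -/
theorem map_inr_map_map_snd_one (χ : A.prod B ⟶ A.prod B) (b : complexBetti B.X 1) :
    complexBetti.map (AbelianVariety.prodLift (0 : B ⟶ A) (𝟙 B)).hom.hom.hom 1
        (complexBetti.map χ.hom.hom.hom 1 (complexBetti.map (AbelianVariety.snd A B).hom.hom.hom 1 b)) =
      complexBetti.map (AbelianVariety.prodLift (0 : B ⟶ A) (𝟙 B) ≫ χ ≫ AbelianVariety.snd A B).hom.hom.hom 1 b := by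
  rw [complexBetti_map_comp_apply, complexBetti_map_comp_apply]

/-- **If `Hom(B, A) = 0`, every `χ ∈ End(A × B)` maps `pr_A^* H¹(A)` into itself**, acting through its
`AA`-entry `φ = (𝟙,0) ≫ χ ≫ pr_A ∈ End(A)`: `χ^* pr_A^* a = pr_A^* φ^* a` (the `BA`-entry
`(0,𝟙) ≫ χ ≫ pr_A ∈ Hom(B, A)` vanishes, and `0^* = 0` on `H¹`). Milne §1 p. 643: equality
`C(A₁ × A₂) = C(A₁) × C(A₂)` "if and only if `Hom(A_i, A_j) = 0`".
[cite: Milne1999LefschetzClasses, §1 p. 643] -/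
theorem map_map_fst_one_of_hom_eq_zero (hBA : ∀ g : B ⟶ A, g = 0) (χ : A.prod B ⟶ A.prod B)
    (a : complexBetti A.X 1) :
    complexBetti.map χ.hom.hom.hom 1 (complexBetti.map (AbelianVariety.fst A B).hom.hom.hom 1 a) =
      complexBetti.map (AbelianVariety.fst A B).hom.hom.hom 1
        (complexBetti.map (AbelianVariety.prodLift (𝟙 A) (0 : A ⟶ B) ≫ χ ≫ AbelianVariety.fst A B).hom.hom.hom 1 a) := by
  have h₂ : complexBetti.map (AbelianVariety.prodLift (0 : B ⟶ A) (𝟙 B)).hom.hom.hom 1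
      (complexBetti.map χ.hom.hom.hom 1 (complexBetti.map (AbelianVariety.fst A B).hom.hom.hom 1 a)) = 0 := by
    rw [show complexBetti.map (AbelianVariety.prodLift (0 : B ⟶ A) (𝟙 B)).hom.hom.hom 1
        (complexBetti.map χ.hom.hom.hom 1 (complexBetti.map (AbelianVariety.fst A B).hom.hom.hom 1 a)) =
        complexBetti.map (AbelianVariety.prodLift (0 : B ⟶ A) (𝟙 B) ≫ χ ≫ AbelianVariety.fst A B).hom.hom.hom 1 a
        from by rw [complexBetti_map_comp_apply, complexBetti_map_comp_apply],
      hBA (AbelianVariety.prodLift (0 : B ⟶ A) (𝟙 B) ≫ χ ≫ AbelianVariety.fst A B), complexBetti_map_zero_one]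
    rfl
  rw [eq_map_fst_add_map_snd_one (complexBetti.map χ.hom.hom.hom 1 _), map_inl_map_map_fst_one, h₂, map_zero,
    add_zero]

/-- **If `Hom(A, B) = 0`, every `χ ∈ End(A × B)` maps `pr_B^* H¹(B)` into itself**, acting through its
`BB`-entry `ψ = (0,𝟙) ≫ χ ≫ pr_B`. [cite: Milne1999LefschetzClasses, §1 p. 643] -/
theorem map_map_snd_one_of_hom_eq_zero (hAB : ∀ f : A ⟶ B, f = 0) (χ : A.prod B ⟶ A.prod B)
    (b : complexBetti B.X 1) :
    complexBetti.map χ.hom.hom.hom 1 (complexBetti.map (AbelianVariety.snd A B).hom.hom.hom 1 b) =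
      complexBetti.map (AbelianVariety.snd A B).hom.hom.hom 1
        (complexBetti.map (AbelianVariety.prodLift (0 : B ⟶ A) (𝟙 B) ≫ χ ≫ AbelianVariety.snd A B).hom.hom.hom 1 b) := by
  have h₁ : complexBetti.map (AbelianVariety.prodLift (𝟙 A) (0 : A ⟶ B)).hom.hom.hom 1
      (complexBetti.map χ.hom.hom.hom 1 (complexBetti.map (AbelianVariety.snd A B).hom.hom.hom 1 b)) = 0 := by
    rw [show complexBetti.map (AbelianVariety.prodLift (𝟙 A) (0 : A ⟶ B)).hom.hom.hom 1
        (complexBetti.map χ.hom.hom.hom 1 (complexBetti.map (AbelianVariety.snd A B).hom.hom.hom 1 b)) =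
        complexBetti.map (AbelianVariety.prodLift (𝟙 A) (0 : A ⟶ B) ≫ χ ≫ AbelianVariety.snd A B).hom.hom.hom 1 b
        from by rw [complexBetti_map_comp_apply, complexBetti_map_comp_apply],
      hAB (AbelianVariety.prodLift (𝟙 A) (0 : A ⟶ B) ≫ χ ≫ AbelianVariety.snd A B), complexBetti_map_zero_one]
    rfl
  rw [eq_map_fst_add_map_snd_one (complexBetti.map χ.hom.hom.hom 1 _), map_inr_map_map_snd_one, h₁, map_zero,
    zero_add]

/-- **If `Hom(A, B) = 0 = Hom(B, A)`, a block-diagonal endomorphism `s ⊕ t` with `s ∈ C(A) ⊗ ℂ`,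
`t ∈ C(B) ⊗ ℂ` commutes with every `χ^*`, `χ ∈ End(A × B)`** — it lies in `C(A × B) ⊗ ℂ` (Milne §1
p. 643: "`C(A) ⊂ C(A₁) × ⋯ × C(A_s)`, with equality holding if and only if `Hom(A_i, A_j) = 0` for all
`i ≠ j`"; `End(A × B) = End(A) × End(B)` acts diagonally on `H¹(A) ⊕ H¹(B)`).
[cite: Milne1999LefschetzClasses, §1 p. 643] -/
theorem prodBlockDiag_apply_map_of_hom_eq_zero (hAB : ∀ f : A ⟶ B, f = 0) (hBA : ∀ g : B ⟶ A, g = 0)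
    {s : Module.End ℂ (complexBetti A.X 1)} {t : Module.End ℂ (complexBetti B.X 1)}
    (hs : ∀ (φ : A ⟶ A) (a : complexBetti A.X 1), s (pullbackOne A φ a) = pullbackOne A φ (s a))
    (ht : ∀ (ψ : B ⟶ B) (b : complexBetti B.X 1), t (pullbackOne B ψ b) = pullbackOne B ψ (t b))
    (χ : A.prod B ⟶ A.prod B) (x : complexBetti (A.prod B).X 1) :
    prodBlockDiag s t (complexBetti.map χ.hom.hom.hom 1 x) = complexBetti.map χ.hom.hom.hom 1 (prodBlockDiag s t x) := by
  rw [eq_map_fst_add_map_snd_one x]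
  set a := complexBetti.map (AbelianVariety.prodLift (𝟙 A) (0 : A ⟶ B)).hom.hom.hom 1 x
  set b := complexBetti.map (AbelianVariety.prodLift (0 : B ⟶ A) (𝟙 B)).hom.hom.hom 1 x
  rw [map_add, map_add, map_add, map_add, map_map_fst_one_of_hom_eq_zero hBA χ a,
    map_map_snd_one_of_hom_eq_zero hAB χ b, prodBlockDiag_apply_map_fst, prodBlockDiag_apply_map_snd,
    prodBlockDiag_apply_map_fst, prodBlockDiag_apply_map_snd, map_map_fst_one_of_hom_eq_zero hBA χ (s a),
    map_map_snd_one_of_hom_eq_zero hAB χ (t b)]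
  exact congrArg₂ (· + ·) (congrArg _ (hs _ _)) (congrArg _ (ht _ _))

/-- **The block-diagonal automorphism `s ⊕ t` of `H¹((A × B)(ℂ); ℂ)`** for automorphisms `s` of
`H¹(A(ℂ); ℂ)` and `t` of `H¹(B(ℂ); ℂ)` (inverse `s⁻¹ ⊕ t⁻¹`): the action of `GL(V(A₁)) × GL(V(A₂))` on
`V(A₁) ⊕ V(A₂)`. [cite: Milne1999LefschetzClasses, §1 p. 643] -/
def prodBlockDiagEquiv (s : complexBetti A.X 1 ≃ₗ[ℂ] complexBetti A.X 1)
    (t : complexBetti B.X 1 ≃ₗ[ℂ] complexBetti B.X 1) :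
    complexBetti (A.prod B).X 1 ≃ₗ[ℂ] complexBetti (A.prod B).X 1 :=
  LinearEquiv.ofLinear (prodBlockDiag s.toLinearMap t.toLinearMap) (prodBlockDiag s.symm.toLinearMap t.symm.toLinearMap)
    (by
      rw [← Module.End.mul_eq_comp, ← prodBlockDiag_mul, ← Module.End.one_eq_id]
      convert prodBlockDiag_one (A := A) (B := B) <;> exact LinearMap.ext fun x ↦ by simp)
    (by
      rw [← Module.End.mul_eq_comp, ← prodBlockDiag_mul, ← Module.End.one_eq_id]
      convert prodBlockDiag_one (A := A) (B := B) <;> exact LinearMap.ext fun x ↦ by simp)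

/-- The underlying linear map of `s ⊕ t` is `prodBlockDiag s t`. [cite: Milne1999LefschetzClasses, §1 p. 643 (V(A₁ × A₂) = V(A₁) ⊕ V(A₂), C(A) ⊂ C(A₁) × C(A₂))] -/
theorem coe_prodBlockDiagEquiv (s : complexBetti A.X 1 ≃ₗ[ℂ] complexBetti A.X 1)
    (t : complexBetti B.X 1 ≃ₗ[ℂ] complexBetti B.X 1) :
    (prodBlockDiagEquiv s t).toLinearMap = prodBlockDiag s.toLinearMap t.toLinearMap :=
  rfl

/-- **If `Hom(A, B) = 0 = Hom(B, A)` then `s ⊕ t ∈ C(A × B)` for `s ∈ C(A)`, `t ∈ C(B)`** (the inclusion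
`C(A₁) × C(A₂) ⊆ C(A₁ × A₂)`, Milne §1 p. 643 / Prop. 1.1). [cite: Milne1999LefschetzClasses, §1 p. 643 and Prop. 1.1] -/
theorem prodBlockDiagEquiv_mem_centralizerGroup (hAB : ∀ f : A ⟶ B, f = 0) (hBA : ∀ g : B ⟶ A, g = 0)
    {s : complexBetti A.X 1 ≃ₗ[ℂ] complexBetti A.X 1} {t : complexBetti B.X 1 ≃ₗ[ℂ] complexBetti B.X 1}
    (hs : s ∈ centralizerGroup A) (ht : t ∈ centralizerGroup B) :
    prodBlockDiagEquiv s t ∈ centralizerGroup (A.prod B) :=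
  fun χ x ↦ prodBlockDiag_apply_map_of_hom_eq_zero hAB hBA (fun φ a ↦ hs φ a) (fun ψ b ↦ ht ψ b) χ x

/-- The `A`-component of `s ⊕ t` is `s`. [cite: Milne1999LefschetzClasses, §1 p. 643 (V(A₁ × A₂) = V(A₁) ⊕ V(A₂), C(A) ⊂ C(A₁) × C(A₂))] -/
theorem centralizerGroup.restrictFstHom_prodBlockDiagEquiv
    {s : complexBetti A.X 1 ≃ₗ[ℂ] complexBetti A.X 1} {t : complexBetti B.X 1 ≃ₗ[ℂ] complexBetti B.X 1}
    (h : prodBlockDiagEquiv s t ∈ centralizerGroup (A.prod B)) :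
    centralizerGroup.restrictFstHom A B ⟨prodBlockDiagEquiv s t, h⟩ = s := by
  refine LinearEquiv.toLinearMap_injective ?_
  rw [centralizerGroup.coe_restrictFstHom]
  exact prodRestrictFst_prodBlockDiag _ _

/-- The `B`-component of `s ⊕ t` is `t`. [cite: Milne1999LefschetzClasses, §1 p. 643 (V(A₁ × A₂) = V(A₁) ⊕ V(A₂), C(A) ⊂ C(A₁) × C(A₂))] -/
theorem centralizerGroup.restrictSndHom_prodBlockDiagEquiv
    {s : complexBetti A.X 1 ≃ₗ[ℂ] complexBetti A.X 1} {t : complexBetti B.X 1 ≃ₗ[ℂ] complexBetti B.X 1}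
    (h : prodBlockDiagEquiv s t ∈ centralizerGroup (A.prod B)) :
    centralizerGroup.restrictSndHom A B ⟨prodBlockDiagEquiv s t, h⟩ = t := by
  refine LinearEquiv.toLinearMap_injective ?_
  rw [centralizerGroup.coe_restrictSndHom]
  exact prodRestrictSnd_prodBlockDiag _ _

/-- **`C(A × B) → C(A) × C(B)` is surjective when `Hom(A, B) = 0 = Hom(B, A)`**: every pair
`(s, t) ∈ C(A) × C(B)` is the pair of components of `s ⊕ t ∈ C(A × B)` (Milne §1 p. 643 / Prop. 1.1:
"`C(A₁) × ⋯ × C(A_s) → C(A)` is an isomorphism"). [cite: Milne1999LefschetzClasses, §1 p. 643 and Prop. 1.1] -/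
theorem centralizerGroup.exists_restrictHom_eq (hAB : ∀ f : A ⟶ B, f = 0) (hBA : ∀ g : B ⟶ A, g = 0)
    {s : complexBetti A.X 1 ≃ₗ[ℂ] complexBetti A.X 1} {t : complexBetti B.X 1 ≃ₗ[ℂ] complexBetti B.X 1}
    (hs : s ∈ centralizerGroup A) (ht : t ∈ centralizerGroup B) :
    ∃ u : centralizerGroup (A.prod B),
      centralizerGroup.restrictFstHom A B u = s ∧ centralizerGroup.restrictSndHom A B u = t :=
  ⟨⟨prodBlockDiagEquiv s t, prodBlockDiagEquiv_mem_centralizerGroup hAB hBA hs ht⟩,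
    centralizerGroup.restrictFstHom_prodBlockDiagEquiv _, centralizerGroup.restrictSndHom_prodBlockDiagEquiv _⟩

/-- **Conversely, if `C(A × B) → C(A) × C(B)` is surjective then `Hom(A, B) = 0 = Hom(B, A)`** (Milne's
"only if"): were `g : B → A` non-zero, the pair `(𝟙, 2) ∈ C(A) × C(B)` would not commute with
`χ = pr_B ≫ g ≫ (𝟙, 0) ∈ End(A × B)`, which maps `pr_A^* H¹(A)` to `pr_B^* H¹(B)` through `g^* ≠ 0`
(faithfulness of `End → End H¹`, `hom_eq_zero_of_complexBetti_map_one_eq_zero`); symmetrically for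
`f : A → B`. [cite: Milne1999LefschetzClasses, §1 p. 643 ("if and only if Hom(A_i, A_j) = 0")] -/
theorem hom_eq_zero_of_restrictHom_surjective
    (h : ∀ s ∈ centralizerGroup A, ∀ t ∈ centralizerGroup B, ∃ u : centralizerGroup (A.prod B),
      centralizerGroup.restrictFstHom A B u = s ∧ centralizerGroup.restrictSndHom A B u = t) :
    (∀ f : A ⟶ B, f = 0) ∧ ∀ g : B ⟶ A, g = 0 := by
  obtain ⟨u, hu₁, hu₂⟩ := h 1 (centralizerGroup A).one_mem (LinearEquiv.smulOfUnit (Units.mk0 (2 : ℂ) two_ne_zero))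
    (similitudeCentralizerGroup_le_centralizerGroup (h := 0) (smulOfUnit_mem_similitudeCentralizerGroup B 0 _))
  have huA : ∀ a : complexBetti A.X 1, (u : complexBetti (A.prod B).X 1 ≃ₗ[ℂ] _)
      (complexBetti.map (AbelianVariety.fst A B).hom.hom.hom 1 a) =
      complexBetti.map (AbelianVariety.fst A B).hom.hom.hom 1 a := fun a ↦ by
    rw [centralizerGroup.apply_map_fst, hu₁]; rfl
  have huB : ∀ b : complexBetti B.X 1, (u : complexBetti (A.prod B).X 1 ≃ₗ[ℂ] _)
      (complexBetti.map (AbelianVariety.snd A B).hom.hom.hom 1 b) =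
      (2 : ℂ) • complexBetti.map (AbelianVariety.snd A B).hom.hom.hom 1 b := fun b ↦ by
    rw [centralizerGroup.apply_map_snd, hu₂, ← map_smul]
    exact congrArg _ (by simp [LinearEquiv.smulOfUnit, Units.smul_def])
  refine ⟨fun f ↦ ?_, fun g ↦ ?_⟩
  · -- `χ = pr_A ≫ f ≫ (0, 𝟙)` maps `pr_B^* H¹(B)` to `pr_A^* H¹(A)` through `f^*`
    apply ComplexMultiplication.hom_eq_zero_of_complexBetti_map_one_eq_zero
    refine LinearMap.ext fun b ↦ ?_
    apply map_fst_injective_one (A := A) (B := B)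
    set χ : A.prod B ⟶ A.prod B := AbelianVariety.fst A B ≫ f ≫ AbelianVariety.prodLift (0 : B ⟶ A) (𝟙 B)
    have hχ : complexBetti.map χ.hom.hom.hom 1 (complexBetti.map (AbelianVariety.snd A B).hom.hom.hom 1 b) =
        complexBetti.map (AbelianVariety.fst A B).hom.hom.hom 1 (complexBetti.map f.hom.hom.hom 1 b) := by
      rw [← complexBetti_map_comp_apply, ← complexBetti_map_comp_apply]
      simp only [χ, Category.assoc, AbelianVariety.prodLift_snd, Category.comp_id]
    have hc := u.2 χ (complexBetti.map (AbelianVariety.snd A B).hom.hom.hom 1 b)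
    change (u : complexBetti (A.prod B).X 1 ≃ₗ[ℂ] _) (complexBetti.map χ.hom.hom.hom 1 _) =
      complexBetti.map χ.hom.hom.hom 1 _ at hc
    rw [hχ, huA, huB, map_smul, hχ] at hc
    change complexBetti.map (AbelianVariety.fst A B).hom.hom.hom 1 (complexBetti.map f.hom.hom.hom 1 b) =
      complexBetti.map (AbelianVariety.fst A B).hom.hom.hom 1 0
    rw [map_zero]
    have e : (2 : ℂ) • complexBetti.map (AbelianVariety.fst A B).hom.hom.hom 1 (complexBetti.map f.hom.hom.hom 1 b) -
        complexBetti.map (AbelianVariety.fst A B).hom.hom.hom 1 (complexBetti.map f.hom.hom.hom 1 b) = 0 := by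
      rw [← hc, sub_self]
    rwa [two_smul, add_sub_cancel_right] at e
  · -- `χ = pr_B ≫ g ≫ (𝟙, 0)` maps `pr_A^* H¹(A)` to `pr_B^* H¹(B)` through `g^*`
    apply ComplexMultiplication.hom_eq_zero_of_complexBetti_map_one_eq_zero
    refine LinearMap.ext fun a ↦ ?_
    apply map_snd_injective_one (A := A) (B := B)
    set χ : A.prod B ⟶ A.prod B := AbelianVariety.snd A B ≫ g ≫ AbelianVariety.prodLift (𝟙 A) (0 : A ⟶ B)
    have hχ : complexBetti.map χ.hom.hom.hom 1 (complexBetti.map (AbelianVariety.fst A B).hom.hom.hom 1 a) =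
        complexBetti.map (AbelianVariety.snd A B).hom.hom.hom 1 (complexBetti.map g.hom.hom.hom 1 a) := by
      rw [← complexBetti_map_comp_apply, ← complexBetti_map_comp_apply]
      simp only [χ, Category.assoc, AbelianVariety.prodLift_fst, Category.comp_id]
    have hc := u.2 χ (complexBetti.map (AbelianVariety.fst A B).hom.hom.hom 1 a)
    change (u : complexBetti (A.prod B).X 1 ≃ₗ[ℂ] _) (complexBetti.map χ.hom.hom.hom 1 _) =
      complexBetti.map χ.hom.hom.hom 1 _ at hc
    rw [hχ, huB, huA, hχ] at hc
    change complexBetti.map (AbelianVariety.snd A B).hom.hom.hom 1 (complexBetti.map g.hom.hom.hom 1 a) =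
      complexBetti.map (AbelianVariety.snd A B).hom.hom.hom 1 0
    rw [map_zero]
    have e : (2 : ℂ) • complexBetti.map (AbelianVariety.snd A B).hom.hom.hom 1 (complexBetti.map g.hom.hom.hom 1 a) -
        complexBetti.map (AbelianVariety.snd A B).hom.hom.hom 1 (complexBetti.map g.hom.hom.hom 1 a) = 0 := by
      rw [hc, sub_self]
    rwa [two_smul, add_sub_cancel_right] at e

variable (A B) in
/-- **Milne 1999 §1 p. 643 / Prop. 1.1, binary case, on `H¹`: `C(A × B) ≅ C(A) × C(B)` when
`Hom(A, B) = 0 = Hom(B, A)`** — the restriction `u ↦ (u_A, u_B)` is an isomorphism of groups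
`(C(A × B) ⊗ ℂ)^× ≅ (C(A) ⊗ ℂ)^× × (C(B) ⊗ ℂ)^×` ("Any such isogeny induces an isomorphism
`C(A₁) × ⋯ × C(A_s) → C(A)`", here for `A = A₁ × A₂` and the identity isogeny).
[cite: Milne1999LefschetzClasses, §1 p. 643 and Prop. 1.1] -/
def centralizerGroup.prodMulEquiv (hAB : ∀ f : A ⟶ B, f = 0) (hBA : ∀ g : B ⟶ A, g = 0) :
    centralizerGroup (A.prod B) ≃* (centralizerGroup A).prod (centralizerGroup B) :=
  MulEquiv.ofBijective
    (((centralizerGroup.restrictFstHom A B).prod (centralizerGroup.restrictSndHom A B)).codRestrict _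
      fun u ↦ Subgroup.mem_prod.2 ⟨centralizerGroup.restrictFstHom_mem u, centralizerGroup.restrictSndHom_mem u⟩)
    ⟨fun u v huv ↦ by
        have e := congrArg Subtype.val huv
        simp only [MonoidHom.codRestrict_apply, MonoidHom.prod_apply, Prod.mk.injEq] at e
        exact centralizerGroup.eq_of_restrictHom_eq e.1 e.2,
      fun st ↦ by
        obtain ⟨u, hu₁, hu₂⟩ := centralizerGroup.exists_restrictHom_eq hAB hBA
          (Subgroup.mem_prod.1 st.2).1 (Subgroup.mem_prod.1 st.2).2
        exact ⟨u, Subtype.ext (Prod.ext hu₁ hu₂)⟩⟩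

/-- The isomorphism `C(A × B) ≅ C(A) × C(B)` is `u ↦ (u_A, u_B)`. [cite: Milne1999LefschetzClasses, Prop. 1.1] -/
theorem centralizerGroup.coe_prodMulEquiv_apply (hAB : ∀ f : A ⟶ B, f = 0) (hBA : ∀ g : B ⟶ A, g = 0)
    (u : centralizerGroup (A.prod B)) :
    ((centralizerGroup.prodMulEquiv A B hAB hBA u : (centralizerGroup A).prod (centralizerGroup B)) :
        (complexBetti A.X 1 ≃ₗ[ℂ] complexBetti A.X 1) × (complexBetti B.X 1 ≃ₗ[ℂ] complexBetti B.X 1)) =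
      (centralizerGroup.restrictFstHom A B u, centralizerGroup.restrictSndHom A B u) :=
  rfl

end HomZero

end Literature.AlgebraicGeometry.Milne1999

end
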